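import Summits.NavierStokesRegularity.NavierStokesRegularity.Theorems.ThreadingFluxCentreVirialHodgeSlaving
import HarnessLib

/-!
# Crux `PoloidalLiouville` (stmt-NavierStokesRegularity-1222, W1), crux idea «centre-virial» (ns-idea-15 g9):
# ★★ (T2) `PoloidalTameLiouville` — UNCONDITIONAL, by name

`poloidalTameLiouville : PoloidalTameLiouville` (by name over the twin `ThreadingFluxCentreVirialDefs`): a steady poloidal
`D`-solution whose radial flux is tame outside a ball is trivial = T1 `radialDominanceLiouville` (tree) + Hodge slaving for
`C²` fields `Hodge.hodgeSlavingShell_C2` (`D`-solutions are `C³ ⊂ C²`) + the card's reduction K4.  Booking (V25-P3):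
information-grade portrait theorem on the steady decaying stratum of W1; W1 movement 0; T0 / Galdi OPEN; NS regularity is NOT
proved.  `--supports stmt-NavierStokesRegularity-1222 --as helper`.  Filed by ns-wall-eng-4 g6 (cell ns-wall-extremal).
[cite: KorobkovPileckasRusso2015, Thm 3.6]
-/

-- the summit and its single sub-problem share the name (CONVENTIONS §1)
set_option linter.dupNamespace false

noncomputable section

namespace Summit.NavierStokesRegularity.NavierStokesRegularity.Theorems.PoloidalLiouville.CentreVirial

open Set Function MeasureTheory Filter Topology
open Literature.Analysis.FluidPDE
open Literature.Analysis.FluidPDE.VectorCalculus (divergence IsDivFree)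
open Summit.NavierStokesRegularity.NavierStokesRegularity.Theorems.PoloidalLiouville.CentreJet
  (E3 IsUnthreadedAbout IsSteadyNSOn)
open scoped RealInnerProductSpace

/-! ## T2 by name -/

section T2

open Literature.Analysis.FluidPDE

/-- ★★ **(T2) `PoloidalTameLiouville` — UNCONDITIONAL.**  A steady poloidal `D`-solution of Navier–Stokes on `ℝ³` (vortex
lines on the spheres about `x₀`: `⟪curl u, x − x₀⟫ ≡ 0`) whose radial flux is tame outside a ball, `|∂_r(r²u_r)| ≤ 2r|u_r|`
for `|x − x₀| ≥ t₀`, is trivial.  = T1 (`radialDominanceLiouville`, tree) + Hodge slaving on spheres in its sphere-free `C²`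
form (`Hodge.hodgeSlavingShell_C2`: Bochner/Weitzenböck transported to shells by radial integration by parts; `D`-solutions are
`C³ ⊂ C²`) + the card's reduction K4.  The card's typed `HodgeSlavingShell` (binder `C¹`) is NOT claimed.  Information-grade
portrait theorem on the steady decaying stratum (booking V25-P3); T0, `PoloidalLiouville` (1222), Galdi's problem OPEN;
NS regularity is NOT proved. [cite: KorobkovPileckasRusso2015, Thm 3.6] -/
theorem poloidalTameLiouville : PoloidalTameLiouville := by
  intro u p x₀ t₀ hD hU ht₀ htame
  refine radialDominanceLiouville u p x₀ t₀ hD ht₀ ?_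
  intro a b ha hab
  have ha0 : 0 < a := lt_of_lt_of_le ht₀ ha
  have hC2 : ContDiff ℝ 2 u := (contDiffOn_univ.mp hD.1.1).of_le (by norm_num)
  have hC1 : ContDiff ℝ 1 u := hC2.of_le (by norm_num)
  have hdiv : ∀ x, divergence u x = 0 := fun x => hD.1.2.2.1 x (mem_univ x)
  have hS := Hodge.hodgeSlavingShell_C2 u x₀ a b hC2 hdiv hU ha0 hab
  have huc : Continuous u := hC1.continuous
  have hm : ContDiff ℝ 1 (mom x₀ u) := (contDiff_id.sub contDiff_const).inner ℝ hC1
  have hmc : Continuous (mom x₀ u) := hm.continuous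
  have hDc : Continuous (radialFluxDeriv x₀ u) := by
    unfold radialFluxDeriv
    exact hmc.add ((hm.continuous_fderiv one_ne_zero).clm_apply (continuous_id.sub continuous_const))
  have hcn : ContinuousOn (fun x : E3 => ‖x - x₀‖) (Metric.closedBall x₀ b \ Metric.ball x₀ a) :=
    (continuous_norm.comp (continuous_id.sub continuous_const)).continuousOn
  have hr0 : ∀ x ∈ Metric.closedBall x₀ b \ Metric.ball x₀ a, ‖x - x₀‖ ^ 5 ≠ 0 := by
    intro x hx
    simp only [Set.mem_sdiff, Metric.mem_ball, dist_eq_norm, not_lt] at hx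
    exact pow_ne_zero 5 (ha0.trans_le hx.2).ne'
  have hI1 : IntegrableOn (fun x => radialFluxDeriv x₀ u x ^ 2 / ‖x - x₀‖ ^ 5) (shell x₀ a b) volume :=
    (integrableOn_of_continuousOn_closedShell ((hDc.pow 2).continuousOn.div (hcn.pow 5) hr0)).2
  have hI2 : IntegrableOn (fun x => 4 * radDensity x₀ u x) (shell x₀ a b) volume := by
    refine (integrableOn_of_continuousOn_closedShell (x₀ := x₀) (a := a) (b := b) ?_).2
    unfold radDensity
    exact continuousOn_const.mul ((hmc.pow 2).continuousOn.div (hcn.pow 5) hr0)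
  have hpt : ∀ x ∈ shell x₀ a b, radialFluxDeriv x₀ u x ^ 2 / ‖x - x₀‖ ^ 5 ≤ 4 * radDensity x₀ u x := by
    intro x hx
    simp only [shell, Set.mem_setOf_eq] at hx
    have hr : 0 < ‖x - x₀‖ := lt_trans ha0 hx.1
    have h5 : 0 < ‖x - x₀‖ ^ 5 := by positivity
    have htx := htame x (le_trans ha hx.1.le)
    have hsq : radialFluxDeriv x₀ u x ^ 2 ≤ 4 * mom x₀ u x ^ 2 := by
      have h0 : 0 ≤ |radialFluxDeriv x₀ u x| := abs_nonneg _
      have h1 : |radialFluxDeriv x₀ u x| ^ 2 ≤ (2 * |mom x₀ u x|) ^ 2 := pow_le_pow_left₀ h0 htx 2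
      have h2 : |radialFluxDeriv x₀ u x| ^ 2 = radialFluxDeriv x₀ u x ^ 2 := sq_abs _
      have h3 : |mom x₀ u x| ^ 2 = mom x₀ u x ^ 2 := sq_abs _
      nlinarith [h1, h2, h3]
    unfold radDensity
    rw [mul_div_assoc']
    exact div_le_div_of_nonneg_right hsq h5.le
  have hmono := setIntegral_mono_on hI1 hI2 (measurableSet_shell x₀ a b) hpt
  have h4 : ∫ x in shell x₀ a b, 4 * radDensity x₀ u x = 4 * ∫ x in shell x₀ a b, radDensity x₀ u x :=
    integral_const_mul 4 _
  calc ∫ x in shell x₀ a b, tanDensity x₀ u x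
      ≤ (1 / 2) * ∫ x in shell x₀ a b, radialFluxDeriv x₀ u x ^ 2 / ‖x - x₀‖ ^ 5 := hS
    _ ≤ (1 / 2) * ∫ x in shell x₀ a b, 4 * radDensity x₀ u x := mul_le_mul_of_nonneg_left hmono (by norm_num)
    _ = 2 * ∫ x in shell x₀ a b, radDensity x₀ u x := by rw [h4]; ring

end T2

end Summit.NavierStokesRegularity.NavierStokesRegularity.Theorems.PoloidalLiouville.CentreVirial
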